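import Literature.Analysis.FluidPDE.Seregin2020CubicLowerBound
import HarnessLib

/-!
# Seregin 2019, §4 (proof of Prop. 1.3), step (4.4): unboundedness on a small cylinder forces the
# cubic quantity to stay above a threshold at all larger scales

Analysis/FluidPDE proofs-only file (theorems only: no definitions, no named facts, no `sorry`),
a tranche of the input `Literature.Analysis.FluidPDE.seregin2019_localWeakL3_epsRegularity`
(`Seregin2019LocalWeakL3.lean`; G. Seregin, *A note on weak solutions to the Navier–Stokes
equations that are locally in `L_∞(L^{3,∞})`*, arXiv:1906.06707 = St. Petersburg Math. J. 32
(2021) 565–576). No Navier–Stokes regularity statement is proved here.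

In the proof of Prop. 1.3 by contradiction (§4, p. 7), the failure of the conclusion
`v^k ∈ L_∞(Q(ε_k r_k))` is converted, through the one-scale regularity condition Prop. 4.1
("if `R⁻² ∫_{Q(z₀,R)} |v|³ < ε⋆(Z)` and `D₀(q,R;z₀) < Z` hold, then … `sup_{Q(z₀,R/2)} |v| ≤ c⋆(Z)/R`",
quoted from [Seregin2016]), into the lower bound (4.4):
`ϱ⁻² ∫_{Q(ϱ)} |v^k|³ > ε⋆/2` for all `ϱ ∈ [2 ε_k r_k, r_k]`. This file proves that conversion in
the tree's vocabulary, with the bounded pressure quantity the tree's scale-invariant bounds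
deliver (the plain `D = cknD` of a gauged pressure, `Seregin2019ScaleInvariantBounds.lean`):

* `Seregin2019.le_cknC_of_unbounded` — for every `L` there are `κ = κ(L) > 0` and a ratio
  `0 < ϑ ≤ 1` such that: if `(u, p)` is a suitable weak solution on an open `Q`, `G` a weak
  gradient, `Q_{r₀}(z) ⊆ Q` (open inclusion — the vertex `z` may sit on the top of `Q`, as the
  centre of `Q(z₀,R)` does in Prop. 1.4), `A(r₀;z), E(r₀;z) < ∞`, `D(r;z) ≤ L` for
  `0 < r ≤ r₀`, and `u` is essentially unbounded on `Q_{ϱ₁}(z)`, then `C(r;z) ≥ κ` for every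
  `r ∈ ]0, r₀]` with `ϱ₁ ≤ ϑ r`.

Proof (the mechanism of Prop. 4.1, one step of it suffices): if `C(r) < κ`, the pressure decay
estimate `D(ϑr) ≤ c(ϑ D(r) + ϑ⁻² C(r))` (Seregin–Šverák 2009, (as13);
`seregin_sverak_pressure_decay_holds`) and `C(ϑ r) ≤ ϑ⁻² C(r)` make `C + D ≤ ε₀³` at the scale
`ϑ r`, and the one-scale ε-regularity criterion at a top-touching cylinder
(`Seregin2020.exists_epsilonRegularity_top`, Caffarelli–Kohn–Nirenberg's Prop. 1 in
Lemarié-Rieusset's shape) bounds `u` on `Q_{ϑr/2}(z) ⊇ Q_{ϱ₁}(z)` — verbatim the argument of the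
tree's `Seregin2020.exists_le_cknC_of_isBackwardSingularPoint`, with "singular point" replaced by
"unbounded on one given cylinder". (Print obtains boundedness on the full `Q(z₀,R/2)`; the
centred sub-cylinder is all that (4.4) uses, the threshold `2ε_k r_k` becoming `ε_k r_k/ϑ`.)

## Mathlib / tree search

Reused: `Seregin2020.exists_epsilonRegularity_top`, `Seregin2020.const_ineq`,
`seregin_sverak_pressure_decay_holds.ratio`, `cknC_le_mul_of_subset`
(`lean search 'le_cknC_of|exists_epsilonRegularity_top'`, 2026-08-28: the singular-point version
only).

## References

* G. Seregin, arXiv:1906.06707 (2019), §4: Prop. 4.1 and (4.4), p. 7. [`Seregin2019`]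
* G. Seregin, Zap. Nauchn. Sem. POMI 444 (2016) 124–132 (Prop. 4.1's source). [Seregin2016]
* G. Seregin, V. Šverák, Comm. PDE 34 (2009) = arXiv:0804.1803, (as13). [`SereginSverak2009`]
* L. Caffarelli, R. Kohn, L. Nirenberg, CPAM 35 (1982), Prop. 1. [`CaffarelliKohnNirenberg1982`]
-/

noncomputable section

open MeasureTheory Set Function Filter Topology TopologicalSpace Metric
open scoped NNReal ENNReal

namespace Literature.Analysis.FluidPDE

namespace Seregin2019

/-- **Seregin 2019, §4, (4.4) via Prop. 4.1: unboundedness on `Q_{ϱ₁}(z)` keeps `C(r; z)` above a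
threshold at all scales `r ≥ ϱ₁/ϑ`.** For every `L ≥ 0` there are `κ = κ(L) > 0` and
`ϑ = ϑ(L) ∈ ]0, 1]` such that: if `(u, p)` is a suitable weak solution (`ν = 1`, no force) on an
open `Q`, `G` a weak spatial gradient of `u` on `Q`, `Q_{r₀}(z) ⊆ Q` (open inclusion) with
`A(r₀; z), E(r₀; z) < ∞`, `D(r; z) ≤ L` for all `0 < r ≤ r₀`, and `u ∉ L^∞(Q_{ϱ₁}(z))`, then
`C(r; z) ≥ κ` for every `0 < r ≤ r₀` with `ϱ₁ ≤ ϑ r / 2`… recorded with the ratio halved into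
`ϑ`: `ϱ₁ ≤ ϑ r`. (Print, p. 7: "`ϱ⁻² ∫_{Q(ϱ)} |v^k|³ > ε⋆/2` for all `ϱ ∈ [2ε_k r_k, r_k]`",
from Prop. 4.1 with `Z` the bound of `D₀`.) [cite: Seregin2019, §4 Prop. 4.1 and (4.4) (p. 7)] -/
theorem le_cknC_of_unbounded (L : ℝ≥0) :
    ∃ κ ϑ : ℝ, 0 < κ ∧ 0 < ϑ ∧ ϑ ≤ 1 ∧
      ∀ (Q : Opens (ℝ × EuclideanSpace ℝ (Fin 3)))
        (u : ℝ → EuclideanSpace ℝ (Fin 3) → EuclideanSpace ℝ (Fin 3))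
        (p : ℝ → EuclideanSpace ℝ (Fin 3) → ℝ)
        (G : ℝ → EuclideanSpace ℝ (Fin 3) → EuclideanSpace ℝ (Fin 3) →L[ℝ] EuclideanSpace ℝ (Fin 3)),
        IsSuitableWeakSolutionOn Q 1 0 u p → HasWeakSpatialGradientOn Q u G →
        ∀ (z : ℝ × EuclideanSpace ℝ (Fin 3)) (r₀ : ℝ), 0 < r₀ →
          parabolicCylinder r₀ z ⊆ (Q : Set (ℝ × EuclideanSpace ℝ (Fin 3))) →
          cknAEss r₀ z u ≠ ∞ → cknE r₀ z G ≠ ∞ →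
          (∀ r ∈ Ioc (0 : ℝ) r₀, cknD r z p ≤ L) →
          ∀ ϱ₁ : ℝ, 0 < ϱ₁ →
            eLpNorm (uncurry u) ∞ (volume.restrict (parabolicCylinder ϱ₁ z)) = ∞ →
            ∀ r ∈ Ioc (0 : ℝ) r₀, ϱ₁ ≤ ϑ * r → ENNReal.ofReal κ ≤ cknC r z u := by
  obtain ⟨ε₀, C₀, hε₀, hC₀, Hreg⟩ := Seregin2020.exists_epsilonRegularity_top
  obtain ⟨c, Hdec⟩ := seregin_sverak_pressure_decay_holds.ratio
  set η : ℝ := ε₀ ^ 3 with hη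
  have hηpos : 0 < η := pow_pos hε₀ 3
  set θ : ℝ := min (1 / 2) (η / (4 * ((c : ℝ) + 1) * ((L : ℝ) + 1))) with hθ
  have hθpos : 0 < θ := lt_min (by norm_num) (by positivity)
  have hθ1 : θ ≤ 1 := (min_le_left _ _).trans (by norm_num)
  set κ : ℝ := η * θ ^ 2 / (4 * ((c : ℝ) + 1)) with hκ
  have hκpos : 0 < κ := by positivity
  refine ⟨κ, θ / 2, hκpos, by positivity, by linarith, fun Q u p G hsw hG z r₀ hr₀ hQ hA₀ hE₀ hD ϱ₁ hϱ₁
    hunb r hr hϱ₁r => ?_⟩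
  by_contra hlt
  rw [not_le] at hlt
  have hr0 : 0 < r := hr.1
  have hrr₀ : r ≤ r₀ := hr.2
  have hθr : 0 < θ * r := mul_pos hθpos hr0
  have hsubr : parabolicCylinder r z ⊆ (Q : Set (ℝ × EuclideanSpace ℝ (Fin 3))) :=
    (parabolicCylinder_mono hr0.le hrr₀ z).trans hQ
  -- ### the pressure at the scale `θ r`
  have hDθ : cknD (θ * r) z p ≤
      (c : ℝ≥0∞) * (ENNReal.ofReal θ * L + ENNReal.ofReal (θ⁻¹ ^ 2) * ENNReal.ofReal κ) := by
    refine (Hdec Q u p hsw.distributional z r θ hr0 hθpos hθ1 hsubr).trans ?_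
    have h1 : cknD r z p ≤ L := hD r hr
    have h2 : cknC r z u ≤ ENNReal.ofReal κ := hlt.le
    gcongr
  -- ### the cubic quantity at the scale `θ r`
  have hCθ : cknC (θ * r) z u ≤ ENNReal.ofReal (θ⁻¹ ^ 2) * ENNReal.ofReal κ := by
    have hsub : parabolicCylinder (θ * r) z ⊆ parabolicCylinder r z :=
      parabolicCylinder_mono hθr.le (mul_le_of_le_one_left hr0.le hθ1) z
    refine (Seregin2020.cknC_le_mul_of_subset hr0 hθr hsub u).trans ?_
    have e : ENNReal.ofReal (r / (θ * r)) ^ 2 = ENNReal.ofReal (θ⁻¹ ^ 2) := by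
      rw [← ENNReal.ofReal_pow (by positivity)]
      congr 1
      field_simp
    rw [e]
    gcongr
  -- ### smallness of `C + D` at the scale `θ r`
  have hsmall : cknC (θ * r) z u + cknD (θ * r) z p ≤ ENNReal.ofReal (ε₀ ^ 3) := by
    have key := Seregin2020.const_ineq hηpos c.2 L.2 hθpos (min_le_right _ _) hκ.le
    calc cknC (θ * r) z u + cknD (θ * r) z p
        ≤ ENNReal.ofReal (θ⁻¹ ^ 2) * ENNReal.ofReal κ +
            (c : ℝ≥0∞) * (ENNReal.ofReal θ * L + ENNReal.ofReal (θ⁻¹ ^ 2) * ENNReal.ofReal κ) :=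
          add_le_add hCθ hDθ
      _ = ENNReal.ofReal ((c : ℝ) * θ * L + ((c : ℝ) + 1) * θ⁻¹ ^ 2 * κ) := by
          have hc0 : (0 : ℝ) ≤ c := c.2
          have hL0 : (0 : ℝ) ≤ L := L.2
          have hθi : (0 : ℝ) ≤ θ⁻¹ ^ 2 := by positivity
          rw [← ENNReal.ofReal_coe_nnreal (p := c), ← ENNReal.ofReal_coe_nnreal (p := L),
            ← ENNReal.ofReal_mul hθpos.le, ← ENNReal.ofReal_mul hθi, ← ENNReal.ofReal_add
              (by positivity) (by positivity), ← ENNReal.ofReal_mul hc0, ← ENNReal.ofReal_add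
              (by positivity) (by positivity)]
          congr 1
          ring
      _ ≤ ENNReal.ofReal (ε₀ ^ 3) := ENNReal.ofReal_le_ofReal key
  -- ### the ε-regularity criterion at the scale `θ r`: `u` bounded on `Q_{θr/2}(z) ⊇ Q_{ϱ₁}(z)`
  have hbound := Hreg Q u p G hsw hG z r₀ hr₀ hQ hA₀ hE₀ ?_ (θ * r) ε₀ hθr
    ((mul_le_of_le_one_left hr0.le hθ1).trans hrr₀) hε₀.le le_rfl hsmall
  · have hfin : eLpNorm (uncurry u) ∞ (volume.restrict (parabolicCylinder (θ * r / 2) z)) < ∞ := by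
      rw [eLpNorm_exponent_top]
      exact eLpNormEssSup_lt_top_of_ae_bound hbound
    have hsub : parabolicCylinder ϱ₁ z ⊆ parabolicCylinder (θ * r / 2) z :=
      parabolicCylinder_mono hϱ₁.le (by linarith) z
    have hfin' : eLpNorm (uncurry u) ∞ (volume.restrict (parabolicCylinder ϱ₁ z)) < ∞ :=
      lt_of_le_of_lt (eLpNorm_mono_measure _ (Measure.restrict_mono hsub le_rfl)) hfin
    exact hfin'.ne hunb
  · -- `D(r₀) < ∞`
    exact ne_top_of_le_ne_top ENNReal.coe_ne_top (hD r₀ ⟨hr₀, le_rfl⟩)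

end Seregin2019

end Literature.Analysis.FluidPDE

end
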